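import Summits.HodgeConjecture.CorCM.Census.OddDegreeParityLawCyclicPrime
import Summits.HodgeConjecture.CorCM.Census.OddSliceTranslation

/-!
# The full slice of the Galois CM type `(ℤ/2p, p)`, representative-free: labels = maps `ℤ/p → ℤ/2`, Pohlmann forms, the Hodge
# lattice, pairs, Galois translation, weights

COR-CM (cell `pub-hodgecm2`), count-neutral kernel census by the binder seat b09 (gen 25; lane CYCLIC-PRIME-FACES = the kernel
form of «Theorem C» of the seat note `HOME/pub-hodgecm2-b09/lean-g24/DEG22-MU.md`, flagged «not formalised» in lit-andre-3's
PORTFOLIO-g14 §6: the `(2^{p−1}−1)/p` generating Galois orbits of the full cyclic slice of prime degree can be taken to be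
RANK-FOUR FACE classes).  Part I of the lane (`CyclicPrimeTypeModel` → `CyclicPrimeTypeSquares` → `CyclicPrimeFacesDescent` →
`CyclicPrimeFacesGenerate` → `CyclicPrimeFacesSlice`).  Bookkeeping definitions + theorems, Mathlib-only mathematics on top of
b17's `Census/OddDegreeParityLawCyclicPrime.lean`; no `decide` table, no certificate, no named fact, no geometry, no `sorry`.
HC_CM is not proved anywhere in this cell; nothing here is a headline and nothing here produces a period.

THE MODEL (dictionary as in `Census/OddDegreeParityLaw.lean`, not formalised).  `F` Galois CM with `G = Gal(F/ℚ) = ℤ/2 × ℤ/p`,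
`p` an odd prime, `c = (1,0)`.  CM types are the graphs of maps `ψ : ℤ/p → ℤ/2` (`Ty p`); the full slice of `(G, c)` is `E` (the two
constant maps) and one simple CM `p`-fold per `G`-orbit of nonconstant maps (b17: the action is FREE, `vadd_eq_self_iff`, so the
`2^p` maps ARE the `2 + 2p·(2^{p−1}−1)/p` eigen-labels of the slice, one label per map — the representative-free labelling of
b30's `Census/FaceSquaresModel.lean`, «label of the eigenline `(T, s)` = the type `T·s⁻¹`»).  In this labelling: the Pohlmann
coefficient of `g = (a, t) ∈ G` at the label `ψ` is `+1` if `ψ t = a` («`g ∈ ψ`») and `−1` otherwise (`coef`), the Hodge lattice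
`H` is the common kernel of the `2p` forms (`hodge`), the conjugate of `ψ` is `ψ + 1`, the divisor classes are `e_ψ + e_{ψ+1}`
(`pairVec`, `pairs`), and `G` acts on labels by `(tw (a,t) ψ)(s) = ψ(s + t) + a`, on exponent vectors by `transl`.  Part V
(`CyclicPrimeFacesSlice`) proves that this is b17's sigma-type model `Pt (AbO p)`, `hodgeLattice (πO p) (φO p)`, `pairs`, `transl`
up to the bijection «label ↦ its type», so that everything here is a statement about the tree's model of record.  Only
`[NeZero p]` is used in this file (the prime enters in parts IV–V).

CONTENT (the `ℤ/2` trivia `zmod2_add_one_eq_iff` is reused from `Census/OddSliceTranslation.lean`).  §1 the action `tw` (`tw_tw`, `twEquiv`), coefficients (`coef_tw`, `coef_add_one`), `transl`/`translHom`, indicator types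
`ind Q = 𝟙_Q` and unit types `δ i` (`ind_add_delta : 𝟙_Q + δ i = 𝟙_{Q∖i}` for `i ∈ Q`, `tw_add_delta`); §2 forms, `H`, pairs
`≤ H` (`pairVec_mem`), `H` is `G`-stable (`transl_mem`), translation of unit vectors (`transl_single`), membership tested on the
forms of `(0, t)` (`mem_hodge_iff`), `e_{χ+1} = pairVec χ − e_χ`; §3 the weight `wt ψ = #{ψ = 1}` (`wt_add_one : wt (ψ+1) = p − wt ψ`,
`wt_tw_zero`, `wt_tw_one`, `wt_ind`, `ind_filter`), types of weight `≥ 2` have two defects, types of weight `≤ 1` are `0` or `δ s`.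
All [folklore].

## References
* [Pohlmann1968] H. Pohlmann, Algebraic cycles on abelian varieties of complex multiplication type, Ann. of Math. 88 (1968), Thm 1.
* [Milne1999] J. S. Milne, Lefschetz motives and the Tate conjecture, Compositio Math. 117 (1999), Prop. 2.1, p. 54.
* [Weil1977HodgeRing] A. Weil, Abelian varieties and the Hodge ring, Œuvres Scientifiques III, [1977c], 421–429.
-/

namespace Summit.HodgeConjecture.CorCM.Census.CyclicPrimeTypeModel

open Finset

/-! ## §1 Labels, the action, coefficients, indicator and unit types (no finiteness needed) -/

section Labels

variable (p : ℕ)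

/-- The labels of the full slice of `(ℤ/2p, p)`: CM types as maps `ℤ/p → ℤ/2`. [folklore] -/
abbrev Ty : Type := ZMod p → ZMod 2

/-- Pohlmann's coefficient of `g = (a, t) ∈ G` at the label `ψ`: `+1` if `ψ t = a` (`g` lies in the type), `−1` otherwise.
[cite: Pohlmann1968, Thm 1] -/
def coef (g : ZMod 2 × ZMod p) (ψ : Ty p) : ℤ := if ψ g.2 = g.1 then 1 else -1

/-- The action of `G = ℤ/2 × ℤ/p` on labels: `(tw (a,t) ψ)(s) = ψ(s + t) + a`. [folklore] -/
def tw (g : ZMod 2 × ZMod p) (ψ : Ty p) : Ty p := fun s => ψ (s + g.2) + g.1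

/-- Galois translate of an exponent vector: `(g·v)(ψ) = v(g⁻¹·ψ)`. [folklore] -/
def transl (g : ZMod 2 × ZMod p) (v : Ty p → ℤ) : Ty p → ℤ := fun ψ => v (tw p (-g) ψ)

/-- `ψ + 1 ≠ ψ` for labels. [folklore] -/
theorem add_one_ne_self (ψ : Ty p) : ψ + 1 ≠ ψ := by
  intro h
  have h0 := congrFun h 0
  simp only [Pi.add_apply, Pi.one_apply] at h0
  exact absurd ((OddSliceUpperBound.zmod2_add_one_eq_iff (ψ 0) (ψ 0)).mp h0) (fun hh => hh rfl)

/-- `ψ + 1 + 1 = ψ`. [folklore] -/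
theorem add_one_add_one (ψ : Ty p) : ψ + 1 + 1 = ψ := by
  funext s
  have key : ∀ u : ZMod 2, u + 1 + 1 = u := by decide
  exact key (ψ s)

/-- The coefficients at conjugate labels are opposite. [folklore] -/
theorem coef_add_one (g : ZMod 2 × ZMod p) (ψ : Ty p) : coef p g (ψ + 1) = -coef p g ψ := by
  have key : ∀ u w : ZMod 2, (if u + 1 = w then (1 : ℤ) else -1) = -(if u = w then (1 : ℤ) else -1) := by decide
  exact key _ _

/-- Composition of twists. [folklore] -/
theorem tw_tw (g h : ZMod 2 × ZMod p) (ψ : Ty p) : tw p g (tw p h ψ) = tw p (h + g) ψ := by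
  funext s
  simp only [tw, Prod.snd_add, Prod.fst_add]
  rw [add_assoc s, add_comm g.2 h.2, add_assoc]

/-- Twisting by `g` then `−g`. [folklore] -/
theorem tw_neg_tw (g : ZMod 2 × ZMod p) (ψ : Ty p) : tw p (-g) (tw p g ψ) = ψ := by
  rw [tw_tw, add_neg_cancel]
  funext s; simp [tw]

/-- Twisting by `−g` then `g`. [folklore] -/
theorem tw_tw_neg (g : ZMod 2 × ZMod p) (ψ : Ty p) : tw p g (tw p (-g) ψ) = ψ := by
  simpa using tw_neg_tw p (-g) ψ

/-- Twisting by `g` as a permutation of the labels. [folklore] -/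
def twEquiv (g : ZMod 2 × ZMod p) : Ty p ≃ Ty p where
  toFun := tw p g
  invFun := tw p (-g)
  left_inv := tw_neg_tw p g
  right_inv := tw_tw_neg p g

/-- Twisting by `(0, 0)` is the identity. [folklore] -/
theorem tw_zero (ψ : Ty p) : tw p 0 ψ = ψ := by
  funext s; simp [tw]

/-- Twisting by `c = (1,0)` is conjugation. [folklore] -/
theorem tw_one_zero (ψ : Ty p) : tw p (1, 0) ψ = ψ + 1 := by
  funext s; simp [tw]

/-- Twisting commutes with conjugation. [folklore] -/
theorem tw_add_one (g : ZMod 2 × ZMod p) (ψ : Ty p) : tw p g (ψ + 1) = tw p g ψ + 1 := by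
  funext s
  simp only [tw, Pi.add_apply, Pi.one_apply]
  ring

/-- A twist by `(1, t)` is the conjugate of the twist by `(0, t)`. [folklore] -/
theorem tw_one (t : ZMod p) (ψ : Ty p) : tw p (1, t) ψ = tw p (0, t) ψ + 1 := by
  funext s; simp [tw]

/-- The coefficient of `h` at a twisted label is the coefficient of `g + h`. [folklore] -/
theorem coef_tw (g h : ZMod 2 × ZMod p) (ψ : Ty p) : coef p h (tw p g ψ) = coef p (g + h) ψ := by
  have key : ∀ u a b : ZMod 2, (u + a = b) ↔ (u = a + b) := by decide
  have e1 : (tw p g ψ) h.2 = h.1 ↔ ψ ((g + h).2) = (g + h).1 := by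
    simp only [tw, Prod.snd_add, Prod.fst_add, add_comm h.2 g.2]
    exact key _ _ _
  unfold coef
  by_cases hc : ψ ((g + h).2) = (g + h).1
  · rw [if_pos hc, if_pos (e1.mpr hc)]
  · rw [if_neg hc, if_neg (fun h' => hc (e1.mp h'))]
/-- The indicator type `𝟙_Q` of a set of places `Q ⊆ ℤ/p`. [folklore] -/
def ind (Q : Finset (ZMod p)) : Ty p := fun s => if s ∈ Q then 1 else 0

/-- The unit type `δ i` (a single defect at the place `i`). [folklore] -/
def δ (i : ZMod p) : Ty p := Pi.single i 1

/-- Values of `δ`. [folklore] -/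
theorem delta_apply (i s : ZMod p) : δ p i s = if s = i then 1 else 0 := by
  unfold δ
  rw [Pi.single_apply]

/-- Erasing a member `i ∈ Q`: `𝟙_Q + δ i = 𝟙_{Q ∖ i}`. [folklore] -/
theorem ind_add_delta {Q : Finset (ZMod p)} {i : ZMod p} (hi : i ∈ Q) : ind p Q + δ p i = ind p (Q.erase i) := by
  funext s
  simp only [Pi.add_apply, ind, delta_apply, Finset.mem_erase]
  have h11 : (1 : ZMod 2) + 1 = 0 := by decide
  by_cases hs : s = i
  · subst hs
    rw [if_pos hi, if_pos rfl, h11, if_neg (fun h => h.1 rfl)]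
  · rw [if_neg hs]
    by_cases hq : s ∈ Q
    · rw [if_pos hq, if_pos ⟨hs, hq⟩, add_zero]
    · rw [if_neg hq, if_neg (fun h => hq h.2), add_zero]

/-- Adjoining a non-member `i ∉ Q`: `𝟙_Q + δ i = 𝟙_{Q ∪ {i}}`. [folklore] -/
theorem ind_add_delta_of_not_mem {Q : Finset (ZMod p)} {i : ZMod p} (hi : i ∉ Q) :
    ind p Q + δ p i = ind p (insert i Q) := by
  funext s
  simp only [Pi.add_apply, ind, delta_apply, Finset.mem_insert]
  by_cases hs : s = i
  · subst hs
    rw [if_neg hi, if_pos rfl, if_pos (Or.inl rfl), zero_add]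
  · rw [if_neg hs]
    by_cases hq : s ∈ Q
    · rw [if_pos hq, if_pos (Or.inr hq), add_zero]
    · rw [if_neg hq, if_neg (fun h => h.elim hs hq), add_zero]

/-- Twist of a unit type at a shifted place. [folklore] -/
theorem delta_apply_add (g : ZMod 2 × ZMod p) (i s : ZMod p) : (δ p i) (s + g.2) = (δ p (i - g.2)) s := by
  rw [delta_apply, delta_apply]
  by_cases h : s = i - g.2
  · rw [if_pos h, if_pos (by rw [h, sub_add_cancel])]
  · rw [if_neg h, if_neg (fun hh => h (by rw [← hh, add_sub_cancel_right]))]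

/-- Twist of a flipped type: `tw g (φ + δ i) = tw g φ + δ (i − g.2)`. [folklore] -/
theorem tw_add_delta (g : ZMod 2 × ZMod p) (φ : Ty p) (i : ZMod p) :
    tw p g (φ + δ p i) = tw p g φ + δ p (i - g.2) := by
  funext s
  simp only [tw, Pi.add_apply]
  rw [delta_apply_add p g i s]
  ring

/-- `transl` as composition with the inverse permutation. [folklore] -/
theorem transl_eq_comp (g : ZMod 2 × ZMod p) (v : Ty p → ℤ) : transl p g v = v ∘ (twEquiv p g).symm := rfl

/-- Translation by `g` as a `ℤ`-linear map. [folklore] -/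
def translHom (g : ZMod 2 × ZMod p) : (Ty p → ℤ) →ₗ[ℤ] (Ty p → ℤ) where
  toFun := transl p g
  map_add' _ _ := rfl
  map_smul' _ _ := rfl

/-- `translHom` is `transl`. [folklore] -/
@[simp] theorem translHom_apply (g : ZMod 2 × ZMod p) (v : Ty p → ℤ) : translHom p g v = transl p g v := rfl

/-- Translation by `0` is the identity. [folklore] -/
theorem transl_zero (v : Ty p → ℤ) : transl p 0 v = v := by
  funext ψ
  simp only [transl, neg_zero, tw_zero]

end Labels

/-! ## §2 Forms, the Hodge lattice, pairs, translation -/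

section Lattice

variable (p : ℕ) [NeZero p]

/-- **The Hodge lattice** of the slice in the representative-free labelling: exponent vectors killed by all Pohlmann forms.
[cite: Pohlmann1968, Thm 1] -/
def hodge : Submodule ℤ (Ty p → ℤ) where
  carrier := {m | ∀ g : ZMod 2 × ZMod p, coef p g ⬝ᵥ m = 0}
  zero_mem' := by intro g; simp
  add_mem' := by
    intro m m' hm hm' g
    rw [dotProduct_add, hm g, hm' g, add_zero]
  smul_mem' := by
    intro c m hm g
    rw [dotProduct_smul, hm g, smul_zero]

/-- The conjugate (divisor) pair through the label `ψ`: `e_ψ + e_{ψ+1}`. [folklore] -/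
def pairVec (ψ : Ty p) : Ty p → ℤ := Pi.single ψ 1 + Pi.single (ψ + 1) 1

/-- The divisor sublattice `P = ℤ⟨pairs⟩`. [folklore] -/
def pairs : Submodule ℤ (Ty p → ℤ) := Submodule.span ℤ (Set.range (pairVec p))

/-- **The pairs are Hodge vectors.** [folklore] -/
theorem pairVec_mem (ψ : Ty p) : pairVec p ψ ∈ hodge p := by
  intro g
  show coef p g ⬝ᵥ (Pi.single ψ 1 + Pi.single (ψ + 1) 1) = 0
  rw [dotProduct_add, dotProduct_single, dotProduct_single, coef_add_one]
  ring

/-- `P ≤ H`. [folklore] -/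
theorem pairs_le_hodge : pairs p ≤ hodge p := by
  refine Submodule.span_le.mpr ?_
  rintro _ ⟨ψ, rfl⟩
  exact pairVec_mem p ψ

/-- The form of `h` on a translate is the form of `g + h`. [folklore] -/
theorem coef_dotProduct_transl (g h : ZMod 2 × ZMod p) (v : Ty p → ℤ) :
    coef p h ⬝ᵥ transl p g v = coef p (g + h) ⬝ᵥ v := by
  rw [transl_eq_comp, dotProduct_comp_equiv_symm]
  congr 1
  funext ψ
  exact coef_tw p g h ψ

/-- **`H` is stable under Galois translation.** [folklore] -/
theorem transl_mem {v : Ty p → ℤ} (hv : v ∈ hodge p) (g : ZMod 2 × ZMod p) : transl p g v ∈ hodge p := by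
  intro h
  rw [coef_dotProduct_transl]
  exact hv (g + h)

/-- Translate of a unit vector. [folklore] -/
theorem transl_single (g : ZMod 2 × ZMod p) (ψ : Ty p) (c : ℤ) :
    transl p g (Pi.single ψ c) = Pi.single (tw p g ψ) c := by
  funext χ
  have hiff : tw p (-g) χ = ψ ↔ χ = tw p g ψ := by
    constructor
    · intro h; rw [← h, tw_tw_neg]
    · intro h; rw [h, tw_neg_tw]
  simp only [transl, Pi.single_apply, hiff]

/-- Membership in `H` can be tested on the forms of `(0, t)`. [folklore] -/
theorem mem_hodge_iff (m : Ty p → ℤ) : m ∈ hodge p ↔ ∀ t : ZMod p, coef p (0, t) ⬝ᵥ m = 0 := by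
  constructor
  · intro h t; exact h (0, t)
  · intro h g
    obtain ⟨a, t⟩ := g
    have h01 : ∀ u : ZMod 2, u = 0 ∨ u = 1 := by decide
    rcases h01 a with rfl | rfl
    · exact h t
    · have hf : coef p (1, t) = -coef p (0, t) := by
        funext ψ
        have key : ∀ u : ZMod 2, (if u = 1 then (1 : ℤ) else -1) = -(if u = 0 then (1 : ℤ) else -1) := by decide
        simp only [coef, Pi.neg_apply]
        exact key (ψ t)
      show coef p (1, t) ⬝ᵥ m = 0
      rw [hf, neg_dotProduct, h t, neg_zero]

/-- The form of `(0, t)` on a unit vector. [folklore] -/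
theorem coef_zero_dotProduct_single (t : ZMod p) (ψ : Ty p) (c : ℤ) :
    coef p (0, t) ⬝ᵥ Pi.single ψ c = (if ψ t = 0 then 1 else -1) * c := by
  rw [dotProduct_single]
  simp only [coef]

/-- A unit vector at a conjugate label is a pair minus the unit vector: `e_{χ+1} = pairVec χ − e_χ`. [folklore] -/
theorem single_add_one (χ : Ty p) : (Pi.single (χ + 1) (1 : ℤ) : Ty p → ℤ) = pairVec p χ - Pi.single χ 1 := by
  unfold pairVec; abel

/-- A unit vector at `χ` is a pair minus the unit vector at the conjugate: `e_χ = pairVec χ − e_{χ+1}`. [folklore] -/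
theorem single_eq_pairVec_sub (χ : Ty p) : (Pi.single χ (1 : ℤ) : Ty p → ℤ) = pairVec p χ - Pi.single (χ + 1) 1 := by
  unfold pairVec; abel

/-! ## §3 Weights -/

/-- The weight `wt ψ = #{s : ψ s = 1}` (number of «defects» of the type). [folklore] -/
def wt (ψ : Ty p) : ℕ := (univ.filter fun s => ψ s = 1).card

/-- The weight is at most `p`. [folklore] -/
theorem wt_le (ψ : Ty p) : wt p ψ ≤ p := by
  unfold wt
  calc (univ.filter fun s => ψ s = 1).card ≤ (univ : Finset (ZMod p)).card := Finset.card_filter_le _ _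
    _ = p := by rw [Finset.card_univ, ZMod.card]

/-- Weight of the conjugate: `wt (ψ + 1) = p − wt ψ`. [folklore] -/
theorem wt_add_one (ψ : Ty p) : wt p (ψ + 1) = p - wt p ψ := by
  unfold wt
  have hfilt : (univ.filter fun s => (ψ + 1) s = 1) = univ.filter fun s => ¬ ψ s = 1 := by
    ext s
    simp only [Finset.mem_filter, Finset.mem_univ, true_and, Pi.add_apply, Pi.one_apply]
    exact OddSliceUpperBound.zmod2_add_one_eq_iff (ψ s) 1
  rw [hfilt]
  have hc := Finset.card_filter_add_card_filter_not (s := (univ : Finset (ZMod p))) (fun s => ψ s = 1)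
  rw [Finset.card_univ, ZMod.card] at hc
  omega

/-- Weight is invariant under translation by `(0, t)`. [folklore] -/
theorem wt_tw_zero (t : ZMod p) (ψ : Ty p) : wt p (tw p (0, t) ψ) = wt p ψ := by
  unfold wt
  refine Finset.card_equiv (Equiv.addRight t) ?_
  intro s
  simp [tw]

/-- Weight of a twist by `(1, t)`: `p − wt ψ`. [folklore] -/
theorem wt_tw_one (t : ZMod p) (ψ : Ty p) : wt p (tw p (1, t) ψ) = p - wt p ψ := by
  rw [tw_one, wt_add_one, wt_tw_zero]

/-- `wt 𝟙_Q = |Q|`. [folklore] -/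
theorem wt_ind (Q : Finset (ZMod p)) : wt p (ind p Q) = Q.card := by
  unfold wt ind
  congr 1
  ext s
  simp only [Finset.mem_filter, Finset.mem_univ, true_and]
  by_cases h : s ∈ Q
  · simp [h]
  · simp [h]

/-- Every type is the indicator of its defect set. [folklore] -/
theorem ind_filter (ψ : Ty p) : ind p (univ.filter fun s => ψ s = 1) = ψ := by
  funext s
  simp only [ind, Finset.mem_filter, Finset.mem_univ, true_and]
  have h01 : ∀ u : ZMod 2, u = 0 ∨ u = 1 := by decide
  rcases h01 (ψ s) with h | h
  · rw [h, if_neg (by decide)]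
  · rw [h, if_pos rfl]

/-- The conjugate of an indicator is the indicator of the complement. [folklore] -/
theorem ind_add_one (Q : Finset (ZMod p)) : ind p Q + 1 = ind p (univ \ Q) := by
  funext s
  have h11 : (1 : ZMod 2) + 1 = 0 := by decide
  simp only [Pi.add_apply, Pi.one_apply, ind, Finset.mem_sdiff, Finset.mem_univ, true_and]
  by_cases hq : s ∈ Q
  · rw [if_pos hq, h11, if_neg (fun h => h hq)]
  · rw [if_neg hq, zero_add, if_pos hq]

/-- A type of weight `≥ 2` has two distinct defects. [folklore] -/
theorem exists_two_defects {φ : Ty p} (h : 2 ≤ wt p φ) : ∃ i j : ZMod p, i ≠ j ∧ φ i = 1 ∧ φ j = 1 := by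
  unfold wt at h
  obtain ⟨i, j, hi, hj, hij⟩ := Finset.one_lt_card_iff.mp h
  simp only [Finset.mem_filter, Finset.mem_univ, true_and] at hi hj
  exact ⟨i, j, hij, hi, hj⟩

/-- A type of weight `≤ 1` is `0` or a unit type. [folklore] -/
theorem eq_zero_or_eq_delta_of_wt_le_one {χ : Ty p} (h : wt p χ ≤ 1) : χ = 0 ∨ ∃ s, χ = δ p s := by
  unfold wt at h
  set Q := univ.filter fun s => χ s = 1 with hQ
  have hχ : χ = ind p Q := (ind_filter p χ).symm
  rcases Nat.lt_or_ge Q.card 1 with h0 | h1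
  · left
    have hQe : Q = ∅ := Finset.card_eq_zero.mp (by omega)
    rw [hχ, hQe]
    funext s; simp [ind]
  · right
    have hQ1 : Q.card = 1 := le_antisymm h h1
    obtain ⟨s, hs⟩ := Finset.card_eq_one.mp hQ1
    refine ⟨s, ?_⟩
    rw [hχ, hs]
    funext s'
    simp only [ind, Finset.mem_singleton, delta_apply]

end Lattice

end Summit.HodgeConjecture.CorCM.Census.CyclicPrimeTypeModel
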